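import Summits.ResolutionOfSingularities.ResolutionOfSingularities.Theorems.ToricLadderDense
import HarnessLib

/-!
# ToricLadder — decomp-res node «ToricLadder» (lens-1 g14 ArchimedeanLadder → g15 DensityLadder → g16
ToricLadder), tree file 5/5

Content VERBATIM from the decomp-res lens-1 g16 file `HOME/decomp-res-lens-1/g16/ToricLadder.lean` (sha256
67376591e05ef26e…; PARTS I–II =
g15 `DensityLadder.lean` @6c32844d l.120–1091 = g14 `ArchimedeanLadder.lean` PART I, all carried verbatim by the
lens), namespace renamed
`…Theses.ToricLadder` ↦ `…Theorems.ToricLadder` (ONE namespace for all five tree files so the lens's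
dot-notation and unqualified references
stay verbatim), `set_option` lines dropped.  HOME = run/shared/lean/pub/decomp-res.  Landed by decomp-res writer g6
as SUPPORT of the
Valuative route item 0641 `LuAlphaPTorsor` (critic rows 113/116 + order 2026-08-30T17:45:44Z: g16 supersedes g15 for
landing; lens-1 WRITER.md);
no Valuative route edit is made by the decomp-res cell (the located residual `NonToricArchLU 2 4` and the port
`ToricAscent 2` stay tree
definitions here, documented, for the Valuative tenure / operator to book).  Two elementary lemmas that restate
landed declarations are
deleted and cited BY NAME instead (gate dedup, p782367): `mem_of_mem_nonunits_of_le` (≡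
`WildSymbol.Birth.nonunits_subset_of_le`, whose module is not importable here) ↦ its one-line Mathlib proof
inlined at the single use, `algebraMap_mem_of_le` ↦
`Literature.AlgebraicGeometry.Resolution.algebraMap_mem_of_le`.

PART III (NEW in g16) §11 toric data (`ToricDenseBelow`), §12 the law one rung down: TORIC ASCENT `ToricAscent e`
(PORT · COSTUME:
Knaf–Kuhlmann 2005 Thm 4.1 over a regular local base + §4 remarks) and `relLU_of_toricDense`, §13 the toric
ladder: cell `ToricDenseLU e d`
(DECIDED-MOD-(CP2019 + PORT) for `e = 2`, `d = 4`), located residual `NonToricArchLU e d` (THE RESIDUAL: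
`NonToricArchLU 2 4`), EXACT cut,
root and host links BY NAME.
(Sources: CossartPiltant2019; KnafKuhlmann2005 arXiv:math/0304159 Thm 4.1 + §4 remarks (1)–(3); KnafKuhlmann2009
arXiv:math/0702856 Prop 3.11, Thm 1.5; SanSaturnino2017 arXiv:1412.7697 Thm 7.5; NovacoskiSpivakovsky2014
arXiv:1204.4751; ZariskiSamuelII.)
-/

noncomputable section

open IsLocalRing Literature.AlgebraicGeometry.Resolution
open Summit.ResolutionOfSingularities.ResolutionOfSingularities.Theses
open Summit.ResolutionOfSingularities.ResolutionOfSingularities.Theorems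
open Summit.ResolutionOfSingularities.ResolutionOfSingularities.Theorems.PfaffLine

namespace Summit.ResolutionOfSingularities.ResolutionOfSingularities.Theorems.ToricLadder

/-! # PART III — the toric cut (gen 16)

## 11. The toric–dense datum: value-independent coordinates over a lower rung -/

section Toric

variable {k K : Type} [Field k] [Field K] [Algebra k K]

/-- The values of the tuple `x` are `ℤ`-INDEPENDENT MODULO THE VALUE GROUP OF `F₁`: no non-trivial
Laurent monomial in the `x i` has the value of an element of `F₁` (this excludes value-torsion as well).
Typed exactly as the hypotheses `hx0`/`hxi` of the tree's `knafKuhlmann2005_thm41_field` and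
`algebraicIndependent_sumElim_of_valIndep` (Bourbaki AC VI §10.3; KK05 Thm. 2.1, requirement (T) of §4:
then `x` is algebraically independent over `F₁`, `Γ_{F₁(x)} = Γ_{F₁} ⊕ ⨁ ℤ·v(x i)` and the residue
field of `F₁(x)` is that of `F₁`).  For `ρ = 1` this is the tree's `IsValueTranscendentalOver`. -/
def IsValIndepOver (O : ValuationSubring K) (F₁ : IntermediateField k K) {ρ : ℕ} (x : Fin ρ → K) :
    Prop :=
  (∀ i, x i ≠ 0) ∧
    ∀ m : Fin ρ → ℤ, (∃ b ∈ F₁, (∏ i, O.valuation (x i) ^ (m i)) = O.valuation b) → m = 0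

/-- The toric extension `F₁(x)` of `F₁` inside `K`, as an intermediate field of `K/k`. -/
def toricField (F₁ : IntermediateField k K) {ρ : ℕ} (x : Fin ρ → K) : IntermediateField k K :=
  F₁ ⊔ IntermediateField.adjoin k (Set.range x)

/-- `le_toricField`: Auxiliary step of this node's calculus, VERBATIM from the lens file (see the module docstring); the statement is its type. [folklore] -/
theorem le_toricField (F₁ : IntermediateField k K) {ρ : ℕ} (x : Fin ρ → K) : F₁ ≤ toricField F₁ x :=
  le_sup_left

/-- `mem_toricField`: Auxiliary step of this node's calculus, VERBATIM from the lens file (see the module docstring); the statement is its type. [folklore] -/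
theorem mem_toricField (F₁ : IntermediateField k K) {ρ : ℕ} (x : Fin ρ → K) (i : Fin ρ) :
    x i ∈ toricField F₁ x :=
  (le_sup_right : IntermediateField.adjoin k (Set.range x) ≤ toricField F₁ x)
    (IntermediateField.subset_adjoin k (Set.range x) ⟨i, rfl⟩)

/-- `toricField_fg`: Auxiliary step of this node's calculus, VERBATIM from the lens file (see the module docstring); the statement is its type. [folklore] -/
theorem toricField_fg (F₁ : IntermediateField k K) (hF₁ : F₁.FG) {ρ : ℕ} (x : Fin ρ → K) :
    (toricField F₁ x).FG :=
  IntermediateField.fg_sup hF₁ (IntermediateField.fg_adjoin_of_finite (Set.finite_range x))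

/-- With no coordinates the toric extension is `F₁` itself. [folklore] -/
theorem toricField_zero (F₁ : IntermediateField k K) (x : Fin 0 → K) : toricField F₁ x = F₁ := by
  have hx : Set.range x = ∅ := Set.range_eq_empty x
  simp [toricField, hx]

/-- A finitely generated intermediate field has transcendence degree `≤ n` for some `n : ℕ`
(tree `trdeg_lt_aleph0_of_fg`). [folklore] -/
theorem exists_nat_trdeg_le_intermediateField (M : IntermediateField k K) (hM : M.FG) :
    ∃ n : ℕ, Algebra.trdeg k M ≤ n := by
  have hfgM : (⊤ : IntermediateField k M).FG :=
    IntermediateField.fg_top_iff.mpr (IntermediateField.essFiniteType_iff.mpr hM)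
  obtain ⟨n, hn⟩ := Cardinal.lt_aleph0.mp (trdeg_lt_aleph0_of_fg hfgM)
  exact ⟨n, hn.le⟩

variable (k) in
/-- **THE CELL DATUM with base bound `e` (`ToricDenseBelow k O e`).**  A TORIC–DENSE PRESENTATION of
`(K, O)` below `e`: a finitely generated intermediate field `F₁` with `tr.deg_k F₁ ≤ e`, a tuple
`x : Fin ρ → K` with values `ℤ`-independent modulo the value group of `F₁`, such that `K` is separably
generated over `F₁(x)` and dense over `F₁(x)` for `O` (`K ⊆ F₁(x)^c`; in particular
`Γ_K = Γ_{F₁} ⊕ ℤ^ρ`).  `ρ = 0` is the gen-15 datum `SepDenseBelow k O e`. -/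
def ToricDenseBelow (O : ValuationSubring K) (e : ℕ) : Prop :=
  ∃ (F₁ : IntermediateField k K) (ρ : ℕ) (x : Fin ρ → K), F₁.FG ∧ Algebra.trdeg k F₁ ≤ e ∧
    IsValIndepOver O F₁ x ∧
    SeparablyGeneratedOver (toricField F₁ x).toSubfield (⊤ : Subfield K) ∧
    IsDenseOver O (toricField F₁ x)

/-- The gen-15 dense datum is the coordinate-free case of the toric–dense datum. [folklore] -/
theorem toricDenseBelow_of_sepDenseBelow (O : ValuationSubring K) {e : ℕ} (h : SepDenseBelow k O e) :
    ToricDenseBelow k O e := by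
  obtain ⟨F₀, hfg, htr, hsep, hdense⟩ := h
  refine ⟨F₀, 0, Fin.elim0, hfg, htr, ⟨fun i => Fin.elim0 i, fun m _ => funext fun i => Fin.elim0 i⟩,
    ?_, ?_⟩
  · rw [toricField_zero]; exact hsep
  · rw [toricField_zero]; exact hdense

/-- `toricDenseBelow_mono`: Auxiliary step of this node's calculus, VERBATIM from the lens file (see the module docstring); the statement is its type. [folklore] -/
theorem toricDenseBelow_mono (O : ValuationSubring K) {e e' : ℕ} (hee : e ≤ e')
    (h : ToricDenseBelow k O e) : ToricDenseBelow k O e' := by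
  obtain ⟨F₁, ρ, x, hfg, htr, hx, hsep, hdense⟩ := h
  exact ⟨F₁, ρ, x, hfg, htr.trans (by exact_mod_cast hee), hx, hsep, hdense⟩

/-! ## 12. The law one rung down: TORIC ASCENT (Knaf–Kuhlmann 2005, Thm. 4.1 over a regular local base) -/

/-- **TORIC ASCENT with base bound `e` (`ToricAscent e`).**  For every valued field `(K, O)` over a
ground field `k` of characteristic `p > 0`, every finitely generated intermediate field `F₁` with
`tr.deg_k F₁ ≤ e` whose valued subfield `(F₁, O ∩ F₁)` admits relative local uniformization over `k`,
and every tuple `x` with values `ℤ`-independent modulo the value group of `F₁`: every finite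
`Z ⊆ O ∩ F₁(x)` lies in a finitely generated `k`-subalgebra `B ⊆ O ∩ F₁(x)` with `Frac B = F₁(x)` whose
local ring at the centre of `O` is REGULAR (hypothesis (hB) of the tree's `stub_relLU_of_regularBase`
for the base field `F₁(x)`).

* `e ≤ 2`: IN PRINT — tag COSTUME (port).  Knaf–Kuhlmann 2005 (Ann. Sci. ÉNS 38 = arXiv:math/0304159)
  Thm. 4.1 (§4, arXiv p. 9, for `F = K(T)` under requirement (T), `R ⊆ K` universally catenary regular
  local dominated by `O_P`, `(R, Z)` with (NC) and (V)) together with §4 remarks (1)–(3) (arXiv p. 11: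
  (NC), (V) hold for EVERY finite `Z` when `dim R ≤ 1`, when `O_K` is discrete, and when `dim R = 2`,
  `R` Nagata — by [A6] = Abhyankar, *Uniformization of Jungian local domains*, Math. Ann. 159 (1965),
  §4 Thm. 2), Lemma 4.2 (Perron; Elliott Thm. 2.2) and Thm. 2.1 (Bourbaki VI §10.3 Thm. 1).  Transfer:
  `R := B_q` for a regular affine model `B ∋` (coefficients of `Z`) of `F₁` given by `RelLU(F₁)`
  (`dim R ≤ tr.deg F₁ ≤ 2`, Nagata and universally catenary as a localisation of an affine `k`-algebra);
  (T) for `F₁(x) | F₁` from `IsValIndepOver` (Thm. 2.1); Thm. 4.1 gives `A = R'[x']` with `A_q` regular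
  and `Z ⊆ A_q`, `R'` an iterated monoidal transform of `R` along `O`, i.e. the local ring of an affine
  blow-up algebra `B' ⊆ O ∩ F₁`; `B := B'[x'][Z] ⊆ O ∩ F₁(x)` is finitely generated, `Frac B = F₁(x)`
  (`F₁(x') = F₁(x)`), and `B_q = A_q` is regular.
* `e = 3`: UNDECIDED · leaf ATTACKABLE-MOD-PRINT.  Thm. 4.1 needs (NC) and (V) for a regular local base
  of dimension 3: (NC) is KK05 §4 remark (4) (arXiv p. 11: [A3] Abhyankar 1966, (5.2.3), for `R` excellent
  and equicharacteristic — ours is); (V) (only parameters with rationally independent values occur) is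
  not packaged in print for rationally dependent parameter values in dimension 3 (KK05 cite only
  D. Fu, J. Algebra 194 (1996) Prop. 3.5, for `k` algebraically closed with `KP = k`).
WEAKER than the root for every `e` (`toricAscent_of_root`). -/
def ToricAscent (e : ℕ) : Prop :=
  ∀ p : ℕ, p.Prime → ∀ (k K : Type) [Field k] [CharP k p] [Field K] [Algebra k K]
    (O : ValuationSubring K), (∀ c : k, algebraMap k K c ∈ O) →
    ∀ F₁ : IntermediateField k K, F₁.FG → Algebra.trdeg k F₁ ≤ e →
    RelLocalUniformization k F₁ (O.comap (algebraMap F₁ K)) →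
    ∀ (ρ : ℕ) (x : Fin ρ → K), IsValIndepOver O F₁ x →
    ∀ Z : Finset K, (∀ z ∈ Z, z ∈ O ∧ z ∈ (toricField F₁ x).toSubfield) →
      ∃ (B : Subalgebra k K) (hB : B.toSubring ≤ O.toSubring),
        (B : Set K) ⊆ (toricField F₁ x).toSubfield ∧ (Z : Set K) ⊆ B ∧ B.FG ∧
        (∀ y ∈ (toricField F₁ x).toSubfield, ∃ a ∈ B, ∃ b ∈ B, y = a / b) ∧
        IsRegularLocalRing
          (Localization.AtPrime (Ideal.comap (Subring.inclusion hB) (IsLocalRing.maximalIdeal O)))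

/-- **K12 · THE KERNEL COMPOSITION (relative LU ascends a toric–dense presentation, given toric ascent
for the base bound).**  Toric ascent supplies regular affine models of `F₁(x)` dominating any finite set
(hB); the dense separably generated top `K | F₁(x)` is strongly smoothly `O ∩ F₁(x)`-uniformizable by the
tree's `PfaffLine.stub_stronglySmoothTopOverAbhyankarSubfield` (KK09 Prop. 3.11 — no Abhyankar
hypothesis in its statement) (hF); the tree's `PfaffLine.stub_relLU_of_regularBase` (KK09 Prop. 3.5 /
Cor. 3.6 over a regular base) concludes. [KnafKuhlmann2005 Thm. 4.1; KnafKuhlmann2009 Prop. 3.11, 3.5, Cor. 3.6] [folklore] -/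
theorem relLU_of_toricDense {p : ℕ} (hp : p.Prime) [CharP k p] {e : ℕ} (hT : ToricAscent e)
    (O : ValuationSubring K) (F₁ : IntermediateField k K) (hF₁fg : F₁.FG) (htr : Algebra.trdeg k F₁ ≤ e)
    (hLU : RelLocalUniformization k F₁ (O.comap (algebraMap F₁ K))) {ρ : ℕ} (x : Fin ρ → K)
    (hx : IsValIndepOver O F₁ x)
    (hsep : SeparablyGeneratedOver (toricField F₁ x).toSubfield (⊤ : Subfield K))
    (hdense : IsDenseOver O (toricField F₁ x)) :
    RelLocalUniformization k K O := by
  classical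
  intro R hR hfrac hRO
  have hk : ∀ c : k, algebraMap k K c ∈ O := algebraMap_mem_of_le O R hRO
  haveI := hfrac
  have htopfg : (⊤ : IntermediateField k K).FG := PfaffLine.intermediateField_top_fg_of_isFractionRing R hR
  have hkF₀ : (algebraMap k K).fieldRange ≤ (toricField F₁ x).toSubfield := by
    intro y hy
    obtain ⟨c, rfl⟩ := RingHom.mem_fieldRange.mp hy
    exact (IntermediateField.mem_toSubfield _ _).mpr ((toricField F₁ x).algebraMap_mem c)
  have hB := hT p hp k K O hk F₁ hF₁fg htr hLU ρ x hx
  have hdense' : ∀ y w : K, w ≠ 0 →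
      ∃ a ∈ (toricField F₁ x).toSubfield, O.valuation (y - a) < O.valuation w := by
    intro y w hw
    obtain ⟨a, ha, hlt⟩ := hdense y w hw
    exact ⟨a, (IntermediateField.mem_toSubfield _ _).mpr ha, hlt⟩
  have hF := stub_stronglySmoothTopOverAbhyankarSubfield k K O htopfg (toricField F₁ x).toSubfield
    hkF₀ hsep hdense'
  obtain ⟨A, h, hRA, hAfg, -, hreg⟩ :=
    stub_relLU_of_regularBase k K O hk (toricField F₁ x).toSubfield hkF₀ hB hF R hR hRO
  exact ⟨A, h, hRA, hAfg, hreg⟩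

end Toric

/-! ## 13. The toric ladder: cell, residual, exact cut, the decided cell `e = 2`, root and host links -/

/-- CELL (decided for `e = 2` modulo the floor and the printed port: `toricDenseLU_two`): valuation rings
of function fields of transcendence degree `≤ n` admitting a toric–dense presentation with base bound `e`. -/
def ToricDenseLU (e n : ℕ) : Prop :=
  ∀ p : ℕ, p.Prime → ∀ (k K : Type) [Field k] [CharP k p] [Field K] [Algebra k K],
    Algebra.trdeg k K ≤ n → ∀ O : ValuationSubring K, ToricDenseBelow k O e →
    RelLocalUniformization k K O

/-- RESIDUAL PIECE (tag UNDECIDED · WEAKER than the root · located residual at `(e, n) = (2, 4)`, true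
residual `(3, 4)`): the gen-15 residual OFF THE TORIC–DENSE LOCUS with base bound `e` — rank-one,
zero-dimensional, non-Abhyankar valuation rings of function fields of transcendence degree `≤ n`, not
separably dense over any finitely generated subfield of transcendence degree `< n`, and admitting NO
toric–dense presentation over a finitely generated subfield of transcendence degree `≤ e`. -/
def NonToricArchLU (e n : ℕ) : Prop :=
  ∀ p : ℕ, p.Prime → ∀ (k K : Type) [Field k] [CharP k p] [Field K] [Algebra k K],
    Algebra.trdeg k K ≤ n → ∀ O : ValuationSubring K, Nonempty O.valuation.RankOne →
    (∀ y ∈ O, ∃ f : Polynomial k, f ≠ 0 ∧ Polynomial.aeval y f ∈ O.nonunits) →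
    ¬ IsAbhyankarPlace O (algebraMap k K).fieldRange ⊤ →
    ¬ (∃ d : ℕ, d < n ∧ SepDenseBelow k O d) → ¬ ToricDenseBelow k O e →
    RelLocalUniformization k K O

/-- `toricDenseLU_of_luRel`: Auxiliary step of this node's calculus, VERBATIM from the lens file (see the module docstring); the statement is its type. [folklore] -/
theorem toricDenseLU_of_luRel {e n : ℕ} (h : LURel n) : ToricDenseLU e n :=
  fun p hp k K _ _ _ _ hd O _ => h p hp k K hd O

/-- `nonToricArchLU_of_nonSepDenseNonAbh`: Auxiliary step of this node's calculus, VERBATIM from the lens file (see the module docstring); the statement is its type. [folklore] -/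
theorem nonToricArchLU_of_nonSepDenseNonAbh {e n : ℕ} (h : NonSepDenseNonAbhArchLU n) :
    NonToricArchLU e n :=
  fun p hp k K _ _ _ _ hd O h1 h0 hA hnd _ => h p hp k K hd O h1 h0 hA hnd

/-- `nonToricArchLU_of_luRel`: Auxiliary step of this node's calculus, VERBATIM from the lens file (see the module docstring); the statement is its type. [folklore] -/
theorem nonToricArchLU_of_luRel {e n : ℕ} (h : LURel n) : NonToricArchLU e n :=
  nonToricArchLU_of_nonSepDenseNonAbh ((nonSepDenseArchLU_iff_nonAbh n).1 (nonSepDenseArchLU_of_luRel h))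

/-- Raising the base bound shrinks the residual. [folklore] -/
theorem nonToricArchLU_mono {e e' n : ℕ} (hee : e ≤ e') (h : NonToricArchLU e n) : NonToricArchLU e' n :=
  fun p hp k K _ _ _ _ hd O h1 h0 hA hnd hnt =>
    h p hp k K hd O h1 h0 hA hnd (fun hD => hnt (toricDenseBelow_mono O hee hD))

/-- **K13 · THE TORIC LAW ON THE LADDER.**  Rung `e` together with toric ascent for base bound `e`
decides the toric–dense cell with base bound `e` at EVERY rung `n`. [folklore] -/
theorem toricDenseLU_of_toricAscent {e : ℕ} (hT : ToricAscent e) (hL : LURel e) (n : ℕ) :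
    ToricDenseLU e n := by
  intro p hp k K _ _ _ _ hn O hD
  obtain ⟨F₁, ρ, x, hF₁fg, htr, hx, hsep, hdense⟩ := hD
  have hL' : RelLocalUniformization k F₁ (O.comap (algebraMap F₁ K)) :=
    hL p hp k F₁ htr (O.comap (algebraMap F₁ K))
  exact relLU_of_toricDense hp hT O F₁ hF₁fg htr hL' x hx hsep hdense

/-- **K14 · THE TORIC CUT of the gen-15 residual** (excluded middle on the toric–dense datum). [folklore] -/
theorem nonSepDenseNonAbh_of_toric_cut {e n : ℕ} (hT : ToricAscent e) (hL : LURel e)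
    (hN : NonToricArchLU e n) : NonSepDenseNonAbhArchLU n := by
  intro p hp k K _ _ _ _ hn O hr hzd hA hnd
  by_cases hD : ToricDenseBelow k O e
  · exact toricDenseLU_of_toricAscent hT hL n p hp k K hn O hD
  · exact hN p hp k K hn O hr hzd hA hnd hD

/-- **EXACT** (EQUIV layer of PART III): given rung `e` and toric ascent for base bound `e`, the gen-15
residual IS its non-toric part. [folklore] -/
theorem nonSepDenseNonAbh_iff_nonToric {e : ℕ} (hT : ToricAscent e) (hL : LURel e) (n : ℕ) :
    NonSepDenseNonAbhArchLU n ↔ NonToricArchLU e n :=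
  ⟨nonToricArchLU_of_nonSepDenseNonAbh, nonSepDenseNonAbh_of_toric_cut hT hL⟩

/-- **NEW CELL, DECIDED-MOD-(CP2019 floor + KK05 Thm 4.1 port)**: at EVERY rung `n`, every valuation of a
function field of transcendence degree `≤ n` in characteristic `p` (any ground field) admitting a
toric–dense presentation over a finitely generated subfield of transcendence degree `≤ 2` admits relative
local uniformization. [folklore] -/
theorem toricDenseLU_two (hCP : CossartPiltant2019LU3.{0}) (hP : ToricAscent 2) (n : ℕ) :
    ToricDenseLU 2 n :=
  toricDenseLU_of_toricAscent hP (luRel_of_le_three hCP (by omega)) n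

/-- **THE LOCATED RESIDUAL, REFINED**: rung 4 is exactly the non-toric (base bound 2) part of the gen-15
residual, modulo the floor and the port. [folklore] -/
theorem luRel_four_iff_nonToric_two (hCP : CossartPiltant2019LU3.{0}) (hP : ToricAscent 2) :
    LURel 4 ↔ NonToricArchLU 2 4 :=
  (luRel_four_iff_nonAbh_four hCP).trans
    (nonSepDenseNonAbh_iff_nonToric hP (luRel_of_le_three hCP (by omega)) 4)

/-- The ATTACKABLE sub-leaf: with toric ascent over THREEFOLD bases (`ToricAscent 3`, UNDECIDED) the
base-bound-2 residual shrinks exactly to the valuations with NO toric–dense presentation at all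
(`NonToricArchLU 3 4`, the true residual: value groups with no coordinate-realised free quotient over
any proper subfield, e.g. `Γ = ℤ[1/p]·(ℤ ⊕ ℤ√2 ⊕ ℤ√3)`). [folklore] -/
theorem nonToricArchLU_two_four_iff_three (hCP : CossartPiltant2019LU3.{0}) (hT : ToricAscent 3) :
    NonToricArchLU 2 4 ↔ NonToricArchLU 3 4 :=
  ⟨nonToricArchLU_mono (by omega), fun h =>
    nonToricArchLU_of_nonSepDenseNonAbh (nonSepDenseNonAbh_of_toric_cut hT (luRel_three_of_cp hCP) h)⟩

/-- `luRel_four_iff_nonToric_three`: Auxiliary step of this node's calculus, VERBATIM from the lens file (see the module docstring); the statement is its type. [folklore] -/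
theorem luRel_four_iff_nonToric_three (hCP : CossartPiltant2019LU3.{0}) (hT : ToricAscent 3) :
    LURel 4 ↔ NonToricArchLU 3 4 :=
  (luRel_four_iff_nonAbh_four hCP).trans (nonSepDenseNonAbh_iff_nonToric hT (luRel_three_of_cp hCP) 4)

/-- **`closes_toric` — ROOT BY NAME (deciding theorem of this node).**  Cossart–Piltant floor (print) +
toric ascent over surface bases (print: KK05 Thm 4.1 + §4 (1)–(3)) + the non-toric residuals in
transcendence degree `≥ 4` + the route's patching crux 0642 ⇒ `ResolutionOfSingularities`. [folklore] -/
theorem closes_toric (hCP : CossartPiltant2019LU3.{0}) (hP : ToricAscent 2)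
    (hN : ∀ d, 4 ≤ d → NonToricArchLU 2 d) (h₃ : Valuative.PatchingRel) :
    _root_.ResolutionOfSingularities :=
  closes_final hCP
    (fun d hd => nonSepDenseNonAbh_of_toric_cut hP (luRel_of_le_three hCP (by omega)) (hN d hd)) h₃

/-- The same through the route's own deciding theorem `Valuative.closes`. [folklore] -/
theorem closes_toric' (hCP : CossartPiltant2019LU3.{0}) (hP : ToricAscent 2)
    (hN : ∀ d, 4 ≤ d → NonToricArchLU 2 d) (h₄ : Valuative.TorsorToLurel)
    (h₃ : Valuative.PatchingRel) : _root_.ResolutionOfSingularities :=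
  Valuative.closes
    (luAlphaPTorsor_of_nonSepDense hCP (fun d hd => (nonSepDenseArchLU_iff_nonAbh d).2
      (nonSepDenseNonAbh_of_toric_cut hP (luRel_of_le_three hCP (by omega)) (hN d hd)))) h₄ h₃

/-- **WEAKER (kernel): the port / law is a consequence of the ROOT** — regular models of the function
field `F₁(x)` come from its own relative local uniformization (`regularBase_of_relLU`). [folklore] -/
theorem toricAscent_of_root (hS : _root_.ResolutionOfSingularities) (e : ℕ) : ToricAscent e := by
  intro p hp k K _ _ _ _ O hk F₁ hF₁fg _ _ ρ x _ Z hZ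
  have hMfg : (toricField F₁ x).FG := toricField_fg F₁ hF₁fg x
  obtain ⟨n, hn⟩ := exists_nat_trdeg_le_intermediateField (toricField F₁ x) hMfg
  have hLU : RelLocalUniformization k (toricField F₁ x)
      (O.comap (algebraMap (toricField F₁ x) K)) :=
    luRel_of_root hS n p hp k (toricField F₁ x) hn (O.comap (algebraMap (toricField F₁ x) K))
  exact regularBase_of_relLU O hk (toricField F₁ x) hMfg hLU Z hZ

/-- `toricAscent_of_hostCone`: Auxiliary step of this node's calculus, VERBATIM from the lens file (see the module docstring); the statement is its type. [folklore] -/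
theorem toricAscent_of_hostCone (h₂ : Valuative.LuAlphaPTorsor) (h₄ : Valuative.TorsorToLurel) (e : ℕ) :
    ToricAscent e := by
  intro p hp k K _ _ _ _ O hk F₁ hF₁fg _ _ ρ x _ Z hZ
  have hMfg : (toricField F₁ x).FG := toricField_fg F₁ hF₁fg x
  obtain ⟨n, hn⟩ := exists_nat_trdeg_le_intermediateField (toricField F₁ x) hMfg
  have hLU : RelLocalUniformization k (toricField F₁ x)
      (O.comap (algebraMap (toricField F₁ x) K)) :=
    luRel_of_hostCone h₂ h₄ n p hp k (toricField F₁ x) hn (O.comap (algebraMap (toricField F₁ x) K))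
  exact regularBase_of_relLU O hk (toricField F₁ x) hMfg hLU Z hZ

/-- **WEAKER (kernel): the cell and the residual are consequences of the ROOT.** [folklore] -/
theorem toricDenseLU_of_root (hS : _root_.ResolutionOfSingularities) (e n : ℕ) : ToricDenseLU e n :=
  toricDenseLU_of_luRel (luRel_of_root hS n)

/-- `nonToricArchLU_of_root`: Auxiliary step of this node's calculus, VERBATIM from the lens file (see the module docstring); the statement is its type. [folklore] -/
theorem nonToricArchLU_of_root (hS : _root_.ResolutionOfSingularities) (e n : ℕ) : NonToricArchLU e n :=
  nonToricArchLU_of_luRel (luRel_of_root hS n)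

/-- **WEAKER than the host's cone.** [folklore] -/
theorem nonToricArchLU_of_hostCone (h₂ : Valuative.LuAlphaPTorsor) (h₄ : Valuative.TorsorToLurel)
    (e n : ℕ) : NonToricArchLU e n :=
  nonToricArchLU_of_luRel (luRel_of_hostCone h₂ h₄ n)

/-- Summary (root-level): `ResolutionOfSingularities` is equivalent, modulo the Cossart–Piltant floor,
the printed toric ascent over surface bases and the route's patching crux, to the NON-TORIC residuals in
transcendence degree `≥ 4`. [folklore] -/
theorem root_iff_nonToric (hCP : CossartPiltant2019LU3.{0}) (hP : ToricAscent 2)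
    (h₃ : Valuative.PatchingRel) :
    _root_.ResolutionOfSingularities ↔ ∀ d, 4 ≤ d → NonToricArchLU 2 d :=
  ⟨fun hS d _ => nonToricArchLU_of_root hS 2 d, fun hN => closes_toric hCP hP hN h₃⟩

/-- Summary (residual-level): the gen-15 residual splits, modulo floor + port, as
`(∀ d ≥ 4, NonSepDenseNonAbhArchLU d) ↔ (∀ d ≥ 4, NonToricArchLU 2 d)`. [folklore] -/
theorem nonSepDenseNonAbh_iff_nonToric_all (hCP : CossartPiltant2019LU3.{0}) (hP : ToricAscent 2) :
    (∀ d, 4 ≤ d → NonSepDenseNonAbhArchLU d) ↔ ∀ d, 4 ≤ d → NonToricArchLU 2 d :=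
  ⟨fun hA d hd => nonToricArchLU_of_nonSepDenseNonAbh (hA d hd),
    fun hN d hd => nonSepDenseNonAbh_of_toric_cut hP (luRel_of_le_three hCP (by omega)) (hN d hd)⟩

end Summit.ResolutionOfSingularities.ResolutionOfSingularities.Theorems.ToricLadder
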